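import Literature.Analysis.FluidPDE.InverseFlowTransport
import HarnessLib

/-!
# Composite and reparametrised inverse pairs (explicit isotopies, bookkeeping)

Topic `Literature/Analysis/FluidPDE`. Continuation of `InverseFlowTransport.lean` (Alberti–Crippa–
Mazzucato 2019, §7, opening remark: the Eulerian velocity `w = ∂ₜΦ ∘ Φ⁻¹` of a flow of
diffeomorphisms and the transport of `ρ̄ ∘ Φ⁻¹`). Explicit building blocks are assembled from
elementary time-dependent maps (shears, squeezes, twists) by COMPOSITION and by TIME
REPARAMETRISATION (profiles flat near `t = 0, 1`); this file records the two closure properties of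
`InverseFlow.IsInversePair` and the corresponding formulas for `InverseFlow.eulerVelocity`:

* `IsInversePair.comp`: `(A_t ∘ B_t, B'_t ∘ A'_t)` is an inverse pair when `(A, A')`, `(B, B')`
  are and `A` is jointly differentiable; `eulerVelocity_comp`:
  `V_{A∘B}(t, x) = V_A(t, x) + D(A_t)(A'_t x)[V_B(t, A'_t x)]` (the velocity of a composite
  motion is the outer velocity plus the push-forward of the inner one);
* `IsInversePair.reparam`: `(X_{θ(t)}, Y_{θ(t)})` is an inverse pair when `X` is jointly
  differentiable; `eulerVelocity_reparam`: `V(t, x) = θ'(t) • V_X(θ(t), x)`.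

All statements are over a real normed space, pointwise where possible. [folklore calculus; the
setting is that of ACM 2019, §7.]

## References

* G. Alberti, G. Crippa, A. L. Mazzucato, *Exponential self-similar mixing by incompressible
  flows*, J. Amer. Math. Soc. 32 (2019), §7, remark before Prop. 21 (arXiv:1605.02090, p. 22).
-/

noncomputable section

open Function
open scoped ContDiff

namespace Literature.Analysis.FluidPDE

namespace InverseFlow

variable {E : Type*} [NormedAddCommGroup E] [NormedSpace ℝ E]

/-! ## Generic slices of a jointly differentiable time-dependent map

The time slice `s ↦ A_s y` (derivative `L (1, 0)`) and the space slice `z ↦ A_t z` (derivative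
`w ↦ L (0, w)`) of a map with space–time derivative `L` at `(t, y)` are
`InverseFlow.hasDerivAt_inverse_apply_one_zero` and `InverseFlow.hasFDerivAt_inverse_slice`
(`InverseFlowTransport.lean`); only the chain rule along a moving point is added here. -/

section Slices

variable {A : ℝ → E → E} {t : ℝ} {y : E} {L : ℝ × E →L[ℝ] E}

/-- Chain rule along a moving point: if `s ↦ c s` has velocity `w` at `t` and `c t = y`, then
`s ↦ A_s (c s)` has derivative `L (1, 0) + L (0, w)` at `t`. [folklore] -/
theorem hasDerivAt_along (hA : HasFDerivAt (uncurry A) L (t, y)) {c : ℝ → E} {w : E}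
    (hc : HasDerivAt c w t) (hct : c t = y) :
    HasDerivAt (fun s => A s (c s)) (L (1, 0) + L (0, w)) t := by
  have hγ : HasDerivAt (fun s => (s, c s)) (1, w) t := (hasDerivAt_id t).prodMk hc
  have hA' : HasFDerivAt (uncurry A) L ((fun s => (s, c s)) t) := by simpa only [hct] using hA
  have h := hA'.comp_hasDerivAt t hγ
  have hsum : L (1, w) = L (1, 0) + L (0, w) := by
    rw [← map_add, Prod.mk_add_mk, add_zero, zero_add]
  rw [← hsum]
  exact h

end Slices

/-! ## Composition -/

section Comp

variable {A A' B B' : ℝ → E → E}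

/-- **Composite inverse pair**: if `(A, A')` and `(B, B')` are inverse pairs and `A` is jointly
differentiable, then `t ↦ A_t ∘ B_t` with inverse `t ↦ B'_t ∘ A'_t` is an inverse pair. [folklore] -/
theorem IsInversePair.comp (hA : IsInversePair A A') (hB : IsInversePair B B')
    (hAd : Differentiable ℝ (uncurry A)) :
    IsInversePair (fun t z => A t (B t z)) (fun t x => B' t (A' t x)) where
  left_inv t z := by rw [hA.left_inv, hB.left_inv]
  right_inv t x := by rw [hB.right_inv, hA.right_inv]
  differentiable_uncurry :=
    hB.differentiable_uncurry.comp (differentiable_fst.prodMk hA.differentiable_uncurry)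
  differentiable_traj z := hAd.comp (differentiable_id.prodMk (hB.differentiable_traj z))

/-- **Velocity of a composite motion**: `V_{A∘B}(t,x) = V_A(t,x) + D(A_t)(A'_t x)[V_B(t, A'_t x)]`.
[folklore] -/
theorem eulerVelocity_comp (hB : IsInversePair B B') (hAd : Differentiable ℝ (uncurry A))
    (t : ℝ) (x : E) :
    eulerVelocity (fun t z => A t (B t z)) (fun t x => B' t (A' t x)) t x =
      eulerVelocity A A' t x + fderiv ℝ (fun z => A t z) (A' t x) (eulerVelocity B B' t (A' t x)) := by
  -- the inner point `z = B'_t (A'_t x)` moves along `s ↦ B_s z`, through `A'_t x` at `s = t`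
  set z : E := B' t (A' t x) with hz
  have hBz : B t z = A' t x := hB.right_inv t _
  have hc : HasDerivAt (fun s => B s z) (eulerVelocity B B' t (A' t x)) t := by
    rw [eulerVelocity_apply]
    exact ((hB.differentiable_traj z) t).hasDerivAt
  have hL := (hAd (t, A' t x)).hasFDerivAt
  have h := hasDerivAt_along hL hc hBz
  rw [eulerVelocity_apply, h.deriv, (hasDerivAt_inverse_apply_one_zero hL).deriv.symm,
    (hasFDerivAt_inverse_slice hL).fderiv, eulerVelocity_apply]
  rfl

end Comp

/-! ## Time reparametrisation -/

section Reparam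

variable {X Y : ℝ → E → E} {θ : ℝ → ℝ}

/-- **Reparametrised inverse pair**: `(X_{θ(t)}, Y_{θ(t)})` for a differentiable time profile
`θ` (e.g. flat near `t = 0, 1`), when `X`, `Y` are jointly differentiable. [folklore] -/
theorem IsInversePair.reparam (h : IsInversePair X Y) (hXd : Differentiable ℝ (uncurry X))
    (hθ : Differentiable ℝ θ) :
    IsInversePair (fun t => X (θ t)) (fun t => Y (θ t)) where
  left_inv t z := h.left_inv (θ t) z
  right_inv t x := h.right_inv (θ t) x
  differentiable_uncurry :=
    h.differentiable_uncurry.comp ((hθ.comp differentiable_fst).prodMk differentiable_snd)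
  differentiable_traj z := hXd.comp (hθ.prodMk (differentiable_const z))

/-- **Velocity of a reparametrised motion**: `V(t, x) = θ'(t) • V_X(θ(t), x)`. [folklore] -/
theorem eulerVelocity_reparam (hXd : Differentiable ℝ (uncurry X)) (hθ : Differentiable ℝ θ)
    (t : ℝ) (x : E) :
    eulerVelocity (fun t => X (θ t)) (fun t => Y (θ t)) t x = deriv θ t • eulerVelocity X Y (θ t) x := by
  rw [eulerVelocity_apply, eulerVelocity_apply]
  -- `s ↦ X (θ s) y` is `(τ ↦ X τ y) ∘ θ`
  have hy : HasDerivAt (fun τ => X τ (Y (θ t) x)) (deriv (fun τ => X τ (Y (θ t) x)) (θ t)) (θ t) :=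
    ((hXd.comp (differentiable_id.prodMk (differentiable_const _))) (θ t)).hasDerivAt
  exact (hy.scomp t (hθ t).hasDerivAt).deriv

end Reparam

end InverseFlow

end Literature.Analysis.FluidPDE
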